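import Literature.MathematicalPhysics.QuantumFieldTheory.ONArchipelagoTermwise
import Literature.MathematicalPhysics.QuantumFieldTheory.ConformalBootstrap3D.TwoSignRows
import HarnessLib

/-!
# The `T` and `A` rows of an `O(N)` archipelago point certificate are two-sign rows

Sixth file of the archipelago rung.  For a point 7-vector `ofPoints z z̄ w` the traceless-symmetric row
`T` and the antisymmetric row `A` of Kos–Poland–Simmons-Duffin–Vichi 2015 §2.1 pair an `F₋` and an `F₊`
point functional at the SAME external exponent `Δ_φ`:
`tensorForm(g) = φ_{a⁻}[F^{Δφ}_-[g]] + φ_{a⁺}[F^{Δφ}_+[g]]` with the combined weights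
`a⁻ = w₀ + (1 − 2/N) w₁`, `a⁺ = −(1 + 2/N) w₂` (`tensorMinusWeights`, `tensorPlusWeights`), and
`antiForm(g)` likewise with `a⁻ = −w₀ + w₁`, `a⁺ = −w₂` (`antiMinusWeights`, `antiPlusWeights`).
Hence the row obligations `TensorPositive` / `AntiPositive` are LITERALLY the two-sign positivity
`TwoSignPositive a⁻ a⁺ z z̄ Δ_φ Δ ℓ` of `ConformalBootstrap3D/TwoSignRows.lean`
(`tensorPositive_ofPoints_iff_twoSignPositive`, `antiPositive_ofPoints_iff_twoSignPositive`; the terms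
agree too, `tensorTerm_eq_twoSignTerm`, `antiTerm_eq_twoSignTerm`), and the whole two-sign toolkit —
termwise rule, rule (M) from one corner number per box (`ruleM_twoSign_of_boxTable`), rule (T) from one
apex inequality, the tail at every point incl. non-regular ones
(`tail_twoSignPositive_of_table_and_apex`) — serves the `T` and `A` rows verbatim: the corollaries
`tail_tensorPositive_of_table_and_apex`, `tail_antiPositive_of_table_and_apex` are the `tail_T` /
`tail_A` items of `ArchipelagoObligations` (indeed for all spins).

With this file every infinite family of obligations of an archipelago point certificate has a
closed-form finite reduction: `T`, `A` here; `S` and the identity in `ONArchipelagoSingletTail.lean`;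
`V` = the `σ–ε` odd rows through `vectorPositive_ofPoints_iff` (`MixedOddTail`-type rules of the
`σ–ε` chain apply to `toOdd`).  No table, no number, no `sorry`.

Sources: arXiv:1504.07997 §2.1 (`KosPolandSimmonsDuffinVichi2015`); F. Kos, D. Poland,
D. Simmons-Duffin, JHEP 06 (2014) 091, §2.1 (`KosPolandSimmonsduffin2014ON`); M. Hogervorst,
S. Rychkov, Phys. Rev. D 87 (2013) 106004, §3 (`HogervorstRychkov2013`).
-/

noncomputable section

namespace Literature.MathematicalPhysics.QuantumFieldTheory.ONArchipelagoSystem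

open Finset Set Filter Topology
open ConformalBootstrap3D (IsConformalBlock3D IsRegularPoint3D unitarityBound3D accidentalDegeneracy3D
  crossF pointFunctional pointFunctional_apply zMono TwoSignPositive twoSignTerm cornerBound₂ apexRest₂
  ruleM_twoSign_of_boxTable tail_twoSignPositive_of_boxes_and_apex tail_twoSignPositive_of_table_and_apex)

namespace ArchipelagoFunctional

/-! ### The combined weights -/

/-- The `F₋` weights of the `T` row: `a⁻_k = w₀ₖ + (1 − 2/N) w₁ₖ`.
[cite: KosPolandSimmonsDuffinVichi2015, §2.1 (seven equations; `V⃗_T`)] -/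
def tensorMinusWeights {n : ℕ} (w : Fin 7 → Fin n → ℝ) (N : ℕ) : Fin n → ℝ :=
  fun k => w 0 k + (1 - 2 / (N : ℝ)) * w 1 k

/-- The `F₊` weights of the `T` row: `a⁺_k = −(1 + 2/N) w₂ₖ`.
[cite: KosPolandSimmonsDuffinVichi2015, §2.1 (seven equations; `V⃗_T`)] -/
def tensorPlusWeights {n : ℕ} (w : Fin 7 → Fin n → ℝ) (N : ℕ) : Fin n → ℝ :=
  fun k => -(1 + 2 / (N : ℝ)) * w 2 k

/-- The `F₋` weights of the `A` row: `a⁻_k = −w₀ₖ + w₁ₖ`.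
[cite: KosPolandSimmonsDuffinVichi2015, §2.1 (seven equations; `V⃗_A`)] -/
def antiMinusWeights {n : ℕ} (w : Fin 7 → Fin n → ℝ) : Fin n → ℝ := fun k => -w 0 k + w 1 k

/-- The `F₊` weights of the `A` row: `a⁺_k = −w₂ₖ`.
[cite: KosPolandSimmonsDuffinVichi2015, §2.1 (seven equations; `V⃗_A`)] -/
def antiPlusWeights {n : ℕ} (w : Fin 7 → Fin n → ℝ) : Fin n → ℝ := fun k => -w 2 k

/-! ### The forms and terms are two-sign rows -/

/-- **The `T` row of a point 7-vector is a two-sign row** on every test function `g`.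
[cite: KosPolandSimmonsduffin2014ON, §2.1 (vector sum rule)] -/
theorem tensorForm_ofPoints_eq_twoSign {n : ℕ} (z zb : Fin n → ℝ) (w : Fin 7 → Fin n → ℝ) (N : ℕ)
    (Δφ : ℝ) (g : ℝ → ℝ → ℝ) :
    (ofPoints z zb w).tensorForm N Δφ g =
      pointFunctional (tensorMinusWeights w N) z zb (crossF Δφ (-1) g) +
        pointFunctional (tensorPlusWeights w N) z zb (crossF Δφ 1 g) := by
  simp only [tensorForm, ofPoints, tensorMinusWeights, tensorPlusWeights, pointFunctional_apply,
    ← Finset.sum_add_distrib, Finset.mul_sum, ← Finset.sum_sub_distrib]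
  exact Finset.sum_congr rfl fun k _ => by ring

/-- **The `A` row of a point 7-vector is a two-sign row** on every test function `g`.
[cite: KosPolandSimmonsduffin2014ON, §2.1 (vector sum rule)] -/
theorem antiForm_ofPoints_eq_twoSign {n : ℕ} (z zb : Fin n → ℝ) (w : Fin 7 → Fin n → ℝ) (Δφ : ℝ)
    (g : ℝ → ℝ → ℝ) :
    (ofPoints z zb w).antiForm Δφ g =
      pointFunctional (antiMinusWeights w) z zb (crossF Δφ (-1) g) +
        pointFunctional (antiPlusWeights w) z zb (crossF Δφ 1 g) := by
  simp only [antiForm, ofPoints, antiMinusWeights, antiPlusWeights, pointFunctional_apply,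
    ← Finset.sum_add_distrib, ← Finset.sum_sub_distrib, ← Finset.sum_neg_distrib]
  exact Finset.sum_congr rfl fun k _ => by ring

/-- `tensorTerm = twoSignTerm a⁻ a⁺` at every monomial. [cite: HogervorstRychkov2013, §3 eq. (3.6)] -/
theorem tensorTerm_eq_twoSignTerm {n : ℕ} (z zb : Fin n → ℝ) (w : Fin 7 → Fin n → ℝ) (N : ℕ)
    (Δφ E : ℝ) (j : ℕ) :
    tensorTerm z zb w N Δφ E j =
      twoSignTerm (tensorMinusWeights w N) (tensorPlusWeights w N) z zb Δφ E j :=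
  tensorTerm_eq_twoSign z zb w N Δφ E j

/-- `antiTerm = twoSignTerm a⁻ a⁺` at every monomial. [cite: HogervorstRychkov2013, §3 eq. (3.6)] -/
theorem antiTerm_eq_twoSignTerm {n : ℕ} (z zb : Fin n → ℝ) (w : Fin 7 → Fin n → ℝ) (Δφ E : ℝ)
    (j : ℕ) :
    antiTerm z zb w Δφ E j = twoSignTerm (antiMinusWeights w) (antiPlusWeights w) z zb Δφ E j :=
  antiTerm_eq_twoSign z zb w Δφ E j

/-- **`TensorPositive` is two-sign positivity** with the combined weights.
[cite: KosPolandSimmonsduffin2014ON, §2.1 (vector sum rule)] -/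
theorem tensorPositive_ofPoints_iff_twoSignPositive {n : ℕ} (z zb : Fin n → ℝ)
    (w : Fin 7 → Fin n → ℝ) (N : ℕ) (Δφ Δ : ℝ) (ℓ : ℕ) :
    (ofPoints z zb w).TensorPositive N Δφ Δ ℓ ↔
      TwoSignPositive (tensorMinusWeights w N) (tensorPlusWeights w N) z zb Δφ Δ ℓ := by
  simp only [TensorPositive, TwoSignPositive, tensorForm_ofPoints_eq_twoSign]

/-- **`AntiPositive` is two-sign positivity** with the combined weights.
[cite: KosPolandSimmonsduffin2014ON, §2.1 (vector sum rule)] -/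
theorem antiPositive_ofPoints_iff_twoSignPositive {n : ℕ} (z zb : Fin n → ℝ)
    (w : Fin 7 → Fin n → ℝ) (Δφ Δ : ℝ) (ℓ : ℕ) :
    (ofPoints z zb w).AntiPositive Δφ Δ ℓ ↔
      TwoSignPositive (antiMinusWeights w) (antiPlusWeights w) z zb Δφ Δ ℓ := by
  simp only [AntiPositive, TwoSignPositive, antiForm_ofPoints_eq_twoSign]

/-! ### The `T` and `A` tails from a finite table and one apex inequality -/

/-- **The `T` tail on a box, all spins and points**, from a two-sign box table on `E ∈ [E₀, E_T)`,
`j + τ ≤ E` (one corner number `cornerBound₂(a⁻+a⁺, a⁻−a⁺) ≥ 0` per box, `Δ_φ ∈ [φ_lo, φ_hi]`) and the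
one apex inequality `R₂(a⁻+a⁺, a⁻−a⁺; φ_lo, E_T) ≤ (a⁻_a + a⁺_a) v_a^{φ_hi}` — the `tail_T` item of
`ArchipelagoObligations` for a point 7-vector (indeed for every spin, not only even ones).
[cite: HogervorstRychkov2013, §3 eq. (3.6)] -/
theorem tail_tensorPositive_of_table_and_apex {n : ℕ} (z zb : Fin n → ℝ) (w : Fin 7 → Fin n → ℝ)
    (N : ℕ) (hz : ∀ k, z k ∈ Ioo (0 : ℝ) 1) (hzb : ∀ k, zb k ∈ Ioo (0 : ℝ) 1) (hord : ∀ k, zb k ≤ z k)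
    (a : Fin n) (ha : 0 ≤ tensorMinusWeights w N a + tensorPlusWeights w N a) (qd qr : Fin n → ℝ)
    (hqd : ∀ k, 0 < qd k ∧ qd k ≤ 1) (hqr : ∀ k, 0 < qr k ∧ qr k ≤ 1)
    (hdomd : ∀ k, z k * zb k ≤ qd k ^ 2 * (z a * zb a) ∧ z k ≤ qd k * z a)
    (hdomr : ∀ k, (1 - z k) * (1 - zb k) ≤ qr k ^ 2 * (z a * zb a) ∧ 1 - zb k ≤ qr k * z a)
    {Q : Set (ℝ × ℝ)} {φlo φhi E₀ ET τ : ℝ} (hQ : ∀ p ∈ Q, φlo ≤ p.1 ∧ p.1 ≤ φhi)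
    (hτ1 : τ ≤ 1) (hτ0 : τ ≤ E₀) (e : ℕ → ℕ → ℝ) (M : ℕ → ℕ)
    (he : ∀ j : ℕ, (j : ℝ) + τ < ET → e j 0 ≤ max E₀ ((j : ℝ) + τ) ∧ ET ≤ e j (M j))
    (hbox : ∀ j : ℕ, (j : ℝ) + τ < ET → ∀ m < M j,
      0 ≤ cornerBound₂ (tensorMinusWeights w N + tensorPlusWeights w N)
        (tensorMinusWeights w N - tensorPlusWeights w N) z zb j (e j m) (e j (m + 1)) φlo φhi)
    (hB : apexRest₂ (tensorMinusWeights w N + tensorPlusWeights w N)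
        (tensorMinusWeights w N - tensorPlusWeights w N) z zb a qd qr φlo ET ≤
      (tensorMinusWeights w N a + tensorPlusWeights w N a) * ((1 - z a) * (1 - zb a)) ^ φhi) :
    ∀ p ∈ Q, ∀ ℓ : ℕ, ∀ Δ : ℝ, unitarityBound3D ℓ ≤ Δ → E₀ ≤ Δ →
      (ofPoints z zb w).TensorPositive N p.1 Δ ℓ :=
  fun p hp ℓ Δ hb h0 => (tensorPositive_ofPoints_iff_twoSignPositive z zb w N p.1 Δ ℓ).2
    (tail_twoSignPositive_of_table_and_apex _ _ z zb hz hzb hord a ha qd qr hqd hqr hdomd hdomr hτ1 hτ0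
      e M he hbox hB p.1 ⟨(hQ p hp).1, (hQ p hp).2⟩ ℓ Δ hb h0)

/-- **The `A` tail on a box, all spins and points** — the `tail_A` item likewise, with the `A`-row
combined weights. [cite: HogervorstRychkov2013, §3 eq. (3.6)] -/
theorem tail_antiPositive_of_table_and_apex {n : ℕ} (z zb : Fin n → ℝ) (w : Fin 7 → Fin n → ℝ)
    (hz : ∀ k, z k ∈ Ioo (0 : ℝ) 1) (hzb : ∀ k, zb k ∈ Ioo (0 : ℝ) 1) (hord : ∀ k, zb k ≤ z k)
    (a : Fin n) (ha : 0 ≤ antiMinusWeights w a + antiPlusWeights w a) (qd qr : Fin n → ℝ)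
    (hqd : ∀ k, 0 < qd k ∧ qd k ≤ 1) (hqr : ∀ k, 0 < qr k ∧ qr k ≤ 1)
    (hdomd : ∀ k, z k * zb k ≤ qd k ^ 2 * (z a * zb a) ∧ z k ≤ qd k * z a)
    (hdomr : ∀ k, (1 - z k) * (1 - zb k) ≤ qr k ^ 2 * (z a * zb a) ∧ 1 - zb k ≤ qr k * z a)
    {Q : Set (ℝ × ℝ)} {φlo φhi E₀ ET τ : ℝ} (hQ : ∀ p ∈ Q, φlo ≤ p.1 ∧ p.1 ≤ φhi)
    (hτ1 : τ ≤ 1) (hτ0 : τ ≤ E₀) (e : ℕ → ℕ → ℝ) (M : ℕ → ℕ)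
    (he : ∀ j : ℕ, (j : ℝ) + τ < ET → e j 0 ≤ max E₀ ((j : ℝ) + τ) ∧ ET ≤ e j (M j))
    (hbox : ∀ j : ℕ, (j : ℝ) + τ < ET → ∀ m < M j,
      0 ≤ cornerBound₂ (antiMinusWeights w + antiPlusWeights w)
        (antiMinusWeights w - antiPlusWeights w) z zb j (e j m) (e j (m + 1)) φlo φhi)
    (hB : apexRest₂ (antiMinusWeights w + antiPlusWeights w) (antiMinusWeights w - antiPlusWeights w)
        z zb a qd qr φlo ET ≤
      (antiMinusWeights w a + antiPlusWeights w a) * ((1 - z a) * (1 - zb a)) ^ φhi) :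
    ∀ p ∈ Q, ∀ ℓ : ℕ, ∀ Δ : ℝ, unitarityBound3D ℓ ≤ Δ → E₀ ≤ Δ →
      (ofPoints z zb w).AntiPositive p.1 Δ ℓ :=
  fun p hp ℓ Δ hb h0 => (antiPositive_ofPoints_iff_twoSignPositive z zb w p.1 Δ ℓ).2
    (tail_twoSignPositive_of_table_and_apex _ _ z zb hz hzb hord a ha qd qr hqd hqr hdomd hdomr hτ1 hτ0
      e M he hbox hB p.1 ⟨(hQ p hp).1, (hQ p hp).2⟩ ℓ Δ hb h0)

end ArchipelagoFunctional

end Literature.MathematicalPhysics.QuantumFieldTheory.ONArchipelagoSystem
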